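import Summits.CriticalPhenomena.CardyFormulaZ2.Theorems.CardyComplexConeParafermionToSLESixFamiliesDiamondDefs
import Literature.Probability.Percolation.DualContours
import HarnessLib

/-!
# The boundary lap of a lattice box: a simple closed lattice walk through the two-layer frame
# (line `potential-darboux-picard-diamond`, S1c `stub_diamondArcsConnected`, part 3)

Crux `ParafermionToSLESixFamilies` (stmt-CriticalPhenomena-11389), line `potential-darboux-picard-diamond`, stub
`stub_diamondArcsConnected` (S1c). In the coordinates `s = x₀ + x₁`, `d = x₁ − x₀` the discrete boundary of a diamond
discretisation is the two-layer frame `s ≤ a + 1 ∨ s ≥ b − 1 ∨ d ≤ a' + 1 ∨ d ≥ b' − 1` of the box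
`a ≤ s ≤ b, a' ≤ d ≤ b'` (part 2). This file constructs the BOUNDARY LAP of the box: the zigzag staircase up the
right side (`s ∈ {b − 1, b}`, one site per `d`: `d ↦ ((b − d)/2, (b − d)/2 + d)`, `d = a' + 1, …, b' − 1`), along the
top (`s ↦ (−(b' − s)/2, s + (b' − s)/2)`, leftwards), down the left side (`d ↦ (−(d − a)/2, d − (d − a)/2)`) and
along the bottom (`s ↦ ((s − a')/2, s − (s − a')/2)`), each of the last three trimmed by one site at a corner where it
would repeat the previous side's last site (a SHARP corner, where the box has a pendant apex: trims
`eT, eL, eB, eR ∈ {0, 1}` read off parities; at a FLAT corner consecutive sides meet along a lattice edge), then closed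
up at the first site. The side ends are `n₁ < n₂ < n₃ < N`.

* `diamondArcs_exists_lap` (registered helper) — for `b − a, b' − a' ≥ 6` there is a closed lattice walk
  `V 0, …, V N = V 0`, `N ≥ 3`, consecutive sites lattice-adjacent, injective on `[0, N)`, through frame sites only,
  visiting every frame site except the apexes `(s, d) ∈ {a, b} × {a', b'}`.

The lemmas `ArcsConn.lap_*` take the trims, side ends and the side-by-side coordinates of the lap as hypotheses
(`hdef`, `hR`, `hT`, `hL`, `hB`, `hE`); the registered theorem instantiates them with the explicit lap.
Pure `ℤ²` arithmetic (`omega` on the zigzag formulas); nothing cited.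
-/

noncomputable section

namespace Summit.CriticalPhenomena.CardyFormulaZ2.Cruxes.ParafermionToSLESixFamilies.PotentialDarbouxPicardDiamond

open Literature.Probability Literature.Probability.LatticeModels

open Literature.Probability.Percolation.Contour (site_ext)

namespace ArcsConn

/-- Lattice adjacency in coordinates. -/
theorem zdGraph_adj_iff_coord (x y : Site 2) : (zdGraph 2).Adj x y ↔
    (y 0 = x 0 ∧ (y 1 = x 1 + 1 ∨ x 1 = y 1 + 1)) ∨ (y 1 = x 1 ∧ (y 0 = x 0 + 1 ∨ x 0 = y 0 + 1)) := by
  rw [zdGraph_adj_iff]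
  constructor
  · rintro ⟨i, h | h⟩ <;> fin_cases i <;> simp [h]
  · rintro (⟨h0, h1 | h1⟩ | ⟨h1, h0 | h0⟩)
    · exact ⟨1, Or.inl (by ext i; fin_cases i <;> simp [h0, h1])⟩
    · exact ⟨1, Or.inr (by ext i; fin_cases i <;> simp [h0, h1])⟩
    · exact ⟨0, Or.inl (by ext i; fin_cases i <;> simp [h0, h1])⟩
    · exact ⟨0, Or.inr (by ext i; fin_cases i <;> simp [h0, h1])⟩

/-! ## The lap, given its trims, side ends and side-by-side coordinates -/

section Lap

variable {a b a' b' eT eL eB eR n₁ n₂ n₃ N : ℤ} {V : ℕ → Site 2}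
  (hq : 6 ≤ b - a ∧ 6 ≤ b' - a')
  (hdef : eT = 1 - (b - b') % 2 ∧ eL = 1 - (b' - a) % 2 ∧ eB = 1 - (a' - a) % 2 ∧ eR = 1 - (b - a') % 2 ∧
    n₁ = b' - a' - 1 ∧ n₂ = n₁ + (b - a - 1 - eT) ∧ n₃ = n₂ + (b' - a' - 1 - eL) ∧ N = n₃ + (b - a - 1 - eB - eR))
  (hR : ∀ i : ℕ, (i : ℤ) < n₁ → V i 0 = (b - (a' + 1 + i)) / 2 ∧ V i 1 = (b - (a' + 1 + i)) / 2 + (a' + 1 + i))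
  (hT : ∀ i : ℕ, n₁ ≤ (i : ℤ) → (i : ℤ) < n₂ → V i 0 = -((b' - (b - 1 - eT - (i - n₁))) / 2) ∧
    V i 1 = (b - 1 - eT - (i - n₁)) + (b' - (b - 1 - eT - (i - n₁))) / 2)
  (hL : ∀ i : ℕ, n₂ ≤ (i : ℤ) → (i : ℤ) < n₃ → V i 0 = -(((b' - 1 - eL - (i - n₂)) - a) / 2) ∧
    V i 1 = (b' - 1 - eL - (i - n₂)) - ((b' - 1 - eL - (i - n₂)) - a) / 2)
  (hB : ∀ i : ℕ, n₃ ≤ (i : ℤ) → (i : ℤ) < N → V i 0 = ((a + 1 + eB + (i - n₃)) - a') / 2 ∧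
    V i 1 = (a + 1 + eB + (i - n₃)) - ((a + 1 + eB + (i - n₃)) - a') / 2)
  (hE : ∀ i : ℕ, N ≤ (i : ℤ) → V i 0 = (b - (a' + 1)) / 2 ∧ V i 1 = (b - (a' + 1)) / 2 + (a' + 1))

include hq hdef in
/-- The side ends increase and the lap is long. -/
theorem lap_mono : 0 < n₁ ∧ n₁ < n₂ ∧ n₂ < n₃ ∧ n₃ < N ∧ 3 ≤ N := by omega

include hq hdef hR hT hL hB hE in
/-- **Every lap site is a frame site.** -/
theorem lap_mem_frame (i : ℕ) :
    (a ≤ V i 0 + V i 1 ∧ V i 0 + V i 1 ≤ b ∧ a' ≤ V i 1 - V i 0 ∧ V i 1 - V i 0 ≤ b') ∧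
      (V i 0 + V i 1 ≤ a + 1 ∨ b - 1 ≤ V i 0 + V i 1 ∨ V i 1 - V i 0 ≤ a' + 1 ∨ b' - 1 ≤ V i 1 - V i 0) := by
  by_cases k1 : (i : ℤ) < n₁
  · obtain ⟨c0, c1⟩ := hR i k1; omega
  by_cases k2 : (i : ℤ) < n₂
  · obtain ⟨c0, c1⟩ := hT i (not_lt.1 k1) k2; omega
  by_cases k3 : (i : ℤ) < n₃
  · obtain ⟨c0, c1⟩ := hL i (not_lt.1 k2) k3; omega
  by_cases k4 : (i : ℤ) < N
  · obtain ⟨c0, c1⟩ := hB i (not_lt.1 k3) k4; omega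
  · obtain ⟨c0, c1⟩ := hE i (not_lt.1 k4); omega

include hq hdef hR hT hL hB hE in
/-- **Consecutive lap sites are lattice neighbours**: inside each side (by parity), at the four corners, and at the
closing. -/
theorem lap_step (i : ℕ) (hi : (i : ℤ) < N) :
    (V (i + 1) 0 = V i 0 ∧ (V (i + 1) 1 = V i 1 + 1 ∨ V i 1 = V (i + 1) 1 + 1)) ∨
      (V (i + 1) 1 = V i 1 ∧ (V (i + 1) 0 = V i 0 + 1 ∨ V i 0 = V (i + 1) 0 + 1)) := by
  obtain ⟨m0, m1, m2, m3, -⟩ := lap_mono hq hdef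
  have hi1 : (((i + 1 : ℕ) : ℤ)) = (i : ℤ) + 1 := by push_cast; ring
  rcases (show ((i : ℤ) + 1 < n₁) ∨ ((i : ℤ) + 1 = n₁) ∨ (n₁ ≤ (i : ℤ) ∧ (i : ℤ) + 1 < n₂) ∨
      (n₁ ≤ (i : ℤ) ∧ (i : ℤ) + 1 = n₂) ∨ (n₂ ≤ (i : ℤ) ∧ (i : ℤ) + 1 < n₃) ∨
      (n₂ ≤ (i : ℤ) ∧ (i : ℤ) + 1 = n₃) ∨ (n₃ ≤ (i : ℤ) ∧ (i : ℤ) + 1 < N) ∨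
      (n₃ ≤ (i : ℤ) ∧ (i : ℤ) + 1 = N) by omega) with k | k | ⟨k, k'⟩ | ⟨k, k'⟩ | ⟨k, k'⟩ | ⟨k, k'⟩ | ⟨k, k'⟩ | ⟨k, k'⟩
  · -- inside the right side: up or left according to the parity of `b - d`
    obtain ⟨c0, c1⟩ := hR i (by omega)
    obtain ⟨d0, d1⟩ := hR (i + 1) (by omega)
    rw [hi1] at d0 d1
    rcases Int.emod_two_eq_zero_or_one (b - (a' + 1 + i)) with hp | hp
    · exact Or.inr ⟨by omega, Or.inr (by omega)⟩
    · exact Or.inl ⟨by omega, Or.inl (by omega)⟩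
  · -- top-right corner: left
    obtain ⟨c0, c1⟩ := hR i (by omega)
    obtain ⟨d0, d1⟩ := hT (i + 1) (by omega) (by omega)
    rw [hi1] at d0 d1
    exact Or.inr ⟨by omega, Or.inr (by omega)⟩
  · -- inside the top side: down or left
    obtain ⟨c0, c1⟩ := hT i k (by omega)
    obtain ⟨d0, d1⟩ := hT (i + 1) (by omega) (by omega)
    rw [hi1] at d0 d1
    rcases Int.emod_two_eq_zero_or_one (b' - (b - 1 - eT - (i - n₁))) with hp | hp
    · exact Or.inl ⟨by omega, Or.inr (by omega)⟩
    · exact Or.inr ⟨by omega, Or.inr (by omega)⟩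
  · -- top-left corner: down
    obtain ⟨c0, c1⟩ := hT i k (by omega)
    obtain ⟨d0, d1⟩ := hL (i + 1) (by omega) (by omega)
    rw [hi1] at d0 d1
    exact Or.inl ⟨by omega, Or.inr (by omega)⟩
  · -- inside the left side: right or down
    obtain ⟨c0, c1⟩ := hL i k (by omega)
    obtain ⟨d0, d1⟩ := hL (i + 1) (by omega) (by omega)
    rw [hi1] at d0 d1
    rcases Int.emod_two_eq_zero_or_one ((b' - 1 - eL - (i - n₂)) - a) with hp | hp
    · exact Or.inr ⟨by omega, Or.inl (by omega)⟩
    · exact Or.inl ⟨by omega, Or.inr (by omega)⟩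
  · -- bottom-left corner: right
    obtain ⟨c0, c1⟩ := hL i k (by omega)
    obtain ⟨d0, d1⟩ := hB (i + 1) (by omega) (by omega)
    rw [hi1] at d0 d1
    exact Or.inr ⟨by omega, Or.inl (by omega)⟩
  · -- inside the bottom side: up or right
    obtain ⟨c0, c1⟩ := hB i k (by omega)
    obtain ⟨d0, d1⟩ := hB (i + 1) (by omega) (by omega)
    rw [hi1] at d0 d1
    rcases Int.emod_two_eq_zero_or_one ((a + 1 + eB + (i - n₃)) - a') with hp | hp
    · exact Or.inl ⟨by omega, Or.inl (by omega)⟩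
    · exact Or.inr ⟨by omega, Or.inl (by omega)⟩
  · -- bottom-right corner (closing up): up
    obtain ⟨c0, c1⟩ := hB i k (by omega)
    obtain ⟨d0, d1⟩ := hE (i + 1) (by omega)
    exact Or.inl ⟨by omega, Or.inl (by omega)⟩

include hR hT hL hB in
/-- The side and side parameter of a lap index below `N`. -/
theorem lap_cases {i : ℕ} (hi : (i : ℤ) < N) :
    ((i : ℤ) < n₁ ∧ V i 0 = (b - (a' + 1 + i)) / 2 ∧ V i 1 = (b - (a' + 1 + i)) / 2 + (a' + 1 + i)) ∨
    (n₁ ≤ (i : ℤ) ∧ (i : ℤ) < n₂ ∧ V i 0 = -((b' - (b - 1 - eT - (i - n₁))) / 2) ∧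
      V i 1 = (b - 1 - eT - (i - n₁)) + (b' - (b - 1 - eT - (i - n₁))) / 2) ∨
    (n₂ ≤ (i : ℤ) ∧ (i : ℤ) < n₃ ∧ V i 0 = -(((b' - 1 - eL - (i - n₂)) - a) / 2) ∧
      V i 1 = (b' - 1 - eL - (i - n₂)) - ((b' - 1 - eL - (i - n₂)) - a) / 2) ∨
    (n₃ ≤ (i : ℤ) ∧ V i 0 = ((a + 1 + eB + (i - n₃)) - a') / 2 ∧
      V i 1 = (a + 1 + eB + (i - n₃)) - ((a + 1 + eB + (i - n₃)) - a') / 2) := by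
  by_cases k1 : (i : ℤ) < n₁
  · exact Or.inl ⟨k1, hR i k1⟩
  by_cases k2 : (i : ℤ) < n₂
  · exact Or.inr (Or.inl ⟨not_lt.1 k1, k2, hT i (not_lt.1 k1) k2⟩)
  by_cases k3 : (i : ℤ) < n₃
  · exact Or.inr (Or.inr (Or.inl ⟨not_lt.1 k2, k3, hL i (not_lt.1 k2) k3⟩))
  · exact Or.inr (Or.inr (Or.inr ⟨not_lt.1 k3, hB i (not_lt.1 k3) hi⟩))

include hq hdef hR hT hL hB in
/-- **The lap does not repeat a site before closing up** (the side and the side parameter are determined by the site;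
at the corners the trims and the parity `s ≡ d` decide). -/
theorem lap_injOn (i j : ℕ) (hij : i < j) (hj : (j : ℤ) < N) : V i ≠ V j := by
  intro h
  have e0 := congrFun h 0
  have e1 := congrFun h 1
  rcases lap_cases hR hT hL hB (i := i) (by omega) with ⟨r1, c0, c1⟩ | ⟨r1, r2, c0, c1⟩ | ⟨r1, r2, c0, c1⟩ | ⟨r1, c0, c1⟩ <;>
  rcases lap_cases hR hT hL hB hj with ⟨s1, d0, d1⟩ | ⟨s1, s2, d0, d1⟩ | ⟨s1, s2, d0, d1⟩ | ⟨s1, d0, d1⟩ <;>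
  omega

include hq hdef hR hE in
/-- The lap closes up. -/
theorem lap_close : V N.toNat = V 0 := by
  obtain ⟨m0, m1, m2, m3, -⟩ := lap_mono hq hdef
  have hN0 : ((N.toNat : ℕ) : ℤ) = N := Int.toNat_of_nonneg (by omega)
  obtain ⟨c0, c1⟩ := hE N.toNat (by omega)
  obtain ⟨d0, d1⟩ := hR 0 (by push_cast; omega)
  push_cast at d0 d1
  exact site_ext (by omega) (by omega)

include hq hdef hR hT hL hB in
/-- **The lap visits every non-apex frame site.** -/
theorem exists_lap_eq (x : Site 2) (hx : a ≤ x 0 + x 1 ∧ x 0 + x 1 ≤ b ∧ a' ≤ x 1 - x 0 ∧ x 1 - x 0 ≤ b')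
    (hfr : x 0 + x 1 ≤ a + 1 ∨ b - 1 ≤ x 0 + x 1 ∨ x 1 - x 0 ≤ a' + 1 ∨ b' - 1 ≤ x 1 - x 0)
    (hna : ¬ ((x 0 + x 1 = a ∨ x 0 + x 1 = b) ∧ (x 1 - x 0 = a' ∨ x 1 - x 0 = b'))) :
    ∃ i : ℕ, (i : ℤ) < N ∧ V i = x := by
  obtain ⟨m0, m1, m2, m3, -⟩ := lap_mono hq hdef
  -- which side (the trims decide the corner sites)
  have key : (b - 1 ≤ x 0 + x 1 ∧ a' + 1 ≤ x 1 - x 0 ∧ x 1 - x 0 ≤ b' - 1) ∨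
      (b' - 1 ≤ x 1 - x 0 ∧ a + 1 ≤ x 0 + x 1 ∧ x 0 + x 1 ≤ b - 1 - eT) ∨
      (x 0 + x 1 ≤ a + 1 ∧ a' + 1 ≤ x 1 - x 0 ∧ x 1 - x 0 ≤ b' - 1 - eL) ∨
      (x 1 - x 0 ≤ a' + 1 ∧ a + 1 + eB ≤ x 0 + x 1 ∧ x 0 + x 1 ≤ b - 1 - eR) := by
    obtain ⟨hb1, hb2, hb3, hb4⟩ := hx
    rcases hfr with h | h | h | h
    · -- left two layers
      by_cases hd1 : x 1 - x 0 ≤ a'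
      · exact Or.inr (Or.inr (Or.inr ⟨by omega, by omega, by omega⟩))
      by_cases hd2 : x 1 - x 0 ≤ b' - 1 - eL
      · exact Or.inr (Or.inr (Or.inl ⟨h, by omega, hd2⟩))
      · exact Or.inr (Or.inl ⟨by omega, by omega, by omega⟩)
    · -- right two layers
      by_cases hd1 : x 1 - x 0 ≤ a'
      · exact Or.inr (Or.inr (Or.inr ⟨by omega, by omega, by omega⟩))
      by_cases hd2 : x 1 - x 0 ≤ b' - 1
      · exact Or.inl ⟨h, by omega, hd2⟩
      · exact Or.inr (Or.inl ⟨by omega, by omega, by omega⟩)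
    · -- bottom two layers
      by_cases hs1 : x 0 + x 1 < a + 1 + eB
      · exact Or.inr (Or.inr (Or.inl ⟨by omega, by omega, by omega⟩))
      by_cases hs2 : x 0 + x 1 ≤ b - 1 - eR
      · exact Or.inr (Or.inr (Or.inr ⟨h, not_lt.1 hs1, hs2⟩))
      · exact Or.inl ⟨by omega, by omega, by omega⟩
    · -- top two layers
      by_cases hs1 : x 0 + x 1 ≤ a
      · exact Or.inr (Or.inr (Or.inl ⟨by omega, by omega, by omega⟩))
      by_cases hs2 : x 0 + x 1 ≤ b - 1 - eT
      · exact Or.inr (Or.inl ⟨h, by omega, hs2⟩)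
      · exact Or.inl ⟨by omega, by omega, by omega⟩
  rcases key with ⟨k1, k2, k3⟩ | ⟨k1, k2, k3⟩ | ⟨k1, k2, k3⟩ | ⟨k1, k2, k3⟩
  · -- right side, `i = d - a' - 1`
    set i : ℕ := (x 1 - x 0 - a' - 1).toNat with hi'
    have hi : (i : ℤ) = x 1 - x 0 - a' - 1 := Int.toNat_of_nonneg (by omega)
    obtain ⟨c0, c1⟩ := hR i (by omega)
    exact ⟨i, by omega, site_ext (by omega) (by omega)⟩
  · -- top side, `i = n₁ + (b - 1 - eT - s)`
    set i : ℕ := (n₁ + (b - 1 - eT - (x 0 + x 1))).toNat with hi'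
    have hi : (i : ℤ) = n₁ + (b - 1 - eT - (x 0 + x 1)) := Int.toNat_of_nonneg (by omega)
    obtain ⟨c0, c1⟩ := hT i (by omega) (by omega)
    exact ⟨i, by omega, site_ext (by omega) (by omega)⟩
  · -- left side, `i = n₂ + (b' - 1 - eL - d)`
    set i : ℕ := (n₂ + (b' - 1 - eL - (x 1 - x 0))).toNat with hi'
    have hi : (i : ℤ) = n₂ + (b' - 1 - eL - (x 1 - x 0)) := Int.toNat_of_nonneg (by omega)
    obtain ⟨c0, c1⟩ := hL i (by omega) (by omega)
    exact ⟨i, by omega, site_ext (by omega) (by omega)⟩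
  · -- bottom side, `i = n₃ + (s - a - 1 - eB)`
    set i : ℕ := (n₃ + (x 0 + x 1 - a - 1 - eB)).toNat with hi'
    have hi : (i : ℤ) = n₃ + (x 0 + x 1 - a - 1 - eB) := Int.toNat_of_nonneg (by omega)
    obtain ⟨c0, c1⟩ := hB i (by omega) (by omega)
    exact ⟨i, by omega, site_ext (by omega) (by omega)⟩

end Lap

end ArcsConn

open ArcsConn

/-- **The boundary lap of a lattice box** (registered helper of `stub_diamondArcsConnected`). For integers with
`b − a ≥ 6`, `b' − a' ≥ 6` there is a closed lattice walk `V 0, …, V N = V 0` (`N ≥ 3`), consecutive sites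
`ℤ²`-adjacent, injective on `[0, N)`, all of whose sites are frame sites of the box (`a ≤ x₀ + x₁ ≤ b`,
`a' ≤ x₁ − x₀ ≤ b'`, and `x₀ + x₁ ≤ a + 1 ∨ x₀ + x₁ ≥ b − 1 ∨ x₁ − x₀ ≤ a' + 1 ∨ x₁ − x₀ ≥ b' − 1`), visiting every frame
site other than the apexes (`x₀ + x₁ ∈ {a, b}` and `x₁ − x₀ ∈ {a', b'}`). -/
theorem diamondArcs_exists_lap : ∀ (a b a' b' : ℤ), 6 ≤ b - a → 6 ≤ b' - a' → ∃ (V : ℕ → Site 2) (N : ℕ), 3 ≤ N ∧ (∀ i : ℕ, i ≤ N → (a ≤ V i 0 + V i 1 ∧ V i 0 + V i 1 ≤ b ∧ a' ≤ V i 1 - V i 0 ∧ V i 1 - V i 0 ≤ b') ∧ (V i 0 + V i 1 ≤ a + 1 ∨ b - 1 ≤ V i 0 + V i 1 ∨ V i 1 - V i 0 ≤ a' + 1 ∨ b' - 1 ≤ V i 1 - V i 0)) ∧ (∀ i : ℕ, i < N → (zdGraph 2).Adj (V i) (V (i + 1))) ∧ V N = V 0 ∧ (∀ i j : ℕ, i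 < j → j < N → V i ≠ V j) ∧ ∀ x : Site 2, (a ≤ x 0 + x 1 ∧ x 0 + x 1 ≤ b ∧ a' ≤ x 1 - x 0 ∧ x 1 - x 0 ≤ b') → (x 0 + x 1 ≤ a + 1 ∨ b - 1 ≤ x 0 + x 1 ∨ x 1 - x 0 ≤ a' + 1 ∨ b' - 1 ≤ x 1 - x 0) → ¬ ((x 0 + x 1 = a ∨ x 0 + x 1 = b) ∧ (x 1 - x 0 = a' ∨ x 1 - x 0 = b')) → ∃ i : ℕ, i < N ∧ V i = x := by
  intro a b a' b' hba hba'
  have hq : 6 ≤ b - a ∧ 6 ≤ b' - a' := ⟨hba, hba'⟩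
  -- the trims at the four corners (`1` iff the corner is sharp) and the side ends, as opaque integers
  obtain ⟨eT, hT⟩ : ∃ e : ℤ, e = 1 - (b - b') % 2 := ⟨_, rfl⟩
  obtain ⟨eL, hL⟩ : ∃ e : ℤ, e = 1 - (b' - a) % 2 := ⟨_, rfl⟩
  obtain ⟨eB, hB⟩ : ∃ e : ℤ, e = 1 - (a' - a) % 2 := ⟨_, rfl⟩
  obtain ⟨eR, hR⟩ : ∃ e : ℤ, e = 1 - (b - a') % 2 := ⟨_, rfl⟩
  obtain ⟨n₁, h1⟩ : ∃ n : ℤ, n = b' - a' - 1 := ⟨_, rfl⟩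
  obtain ⟨n₂, h2⟩ : ∃ n : ℤ, n = n₁ + (b - a - 1 - eT) := ⟨_, rfl⟩
  obtain ⟨n₃, h3⟩ : ∃ n : ℤ, n = n₂ + (b' - a' - 1 - eL) := ⟨_, rfl⟩
  obtain ⟨N, hN⟩ : ∃ n : ℤ, n = n₃ + (b - a - 1 - eB - eR) := ⟨_, rfl⟩
  have hdef : eT = 1 - (b - b') % 2 ∧ eL = 1 - (b' - a) % 2 ∧ eB = 1 - (a' - a) % 2 ∧ eR = 1 - (b - a') % 2 ∧
      n₁ = b' - a' - 1 ∧ n₂ = n₁ + (b - a - 1 - eT) ∧ n₃ = n₂ + (b' - a' - 1 - eL) ∧ N = n₃ + (b - a - 1 - eB - eR) :=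
    ⟨hT, hL, hB, hR, h1, h2, h3, hN⟩
  obtain ⟨m0, m1, m2, m3, hN3⟩ := lap_mono hq hdef
  -- the lap
  obtain ⟨V, hV⟩ : ∃ V : ℕ → Site 2, V = fun i : ℕ =>
      if (i : ℤ) < n₁ then ![(b - (a' + 1 + i)) / 2, (b - (a' + 1 + i)) / 2 + (a' + 1 + i)]
      else if (i : ℤ) < n₂ then ![-((b' - (b - 1 - eT - (i - n₁))) / 2),
        (b - 1 - eT - (i - n₁)) + (b' - (b - 1 - eT - (i - n₁))) / 2]
      else if (i : ℤ) < n₃ then ![-(((b' - 1 - eL - (i - n₂)) - a) / 2),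
        (b' - 1 - eL - (i - n₂)) - ((b' - 1 - eL - (i - n₂)) - a) / 2]
      else if (i : ℤ) < N then ![((a + 1 + eB + (i - n₃)) - a') / 2,
        (a + 1 + eB + (i - n₃)) - ((a + 1 + eB + (i - n₃)) - a') / 2]
      else ![(b - (a' + 1)) / 2, (b - (a' + 1)) / 2 + (a' + 1)] := ⟨_, rfl⟩
  -- its coordinates, side by side
  have lR : ∀ i : ℕ, (i : ℤ) < n₁ →
      V i 0 = (b - (a' + 1 + i)) / 2 ∧ V i 1 = (b - (a' + 1 + i)) / 2 + (a' + 1 + i) := by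
    intro i h; rw [hV]; dsimp only; rw [if_pos h]; exact ⟨rfl, rfl⟩
  have lT : ∀ i : ℕ, n₁ ≤ (i : ℤ) → (i : ℤ) < n₂ → V i 0 = -((b' - (b - 1 - eT - (i - n₁))) / 2) ∧
      V i 1 = (b - 1 - eT - (i - n₁)) + (b' - (b - 1 - eT - (i - n₁))) / 2 := by
    intro i k1 h; rw [hV]; dsimp only; rw [if_neg (not_lt.2 k1), if_pos h]; exact ⟨rfl, rfl⟩
  have lL : ∀ i : ℕ, n₂ ≤ (i : ℤ) → (i : ℤ) < n₃ → V i 0 = -(((b' - 1 - eL - (i - n₂)) - a) / 2) ∧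
      V i 1 = (b' - 1 - eL - (i - n₂)) - ((b' - 1 - eL - (i - n₂)) - a) / 2 := by
    intro i k2 h
    have k1 : ¬ (i : ℤ) < n₁ := by omega
    rw [hV]; dsimp only; rw [if_neg k1, if_neg (not_lt.2 k2), if_pos h]; exact ⟨rfl, rfl⟩
  have lB : ∀ i : ℕ, n₃ ≤ (i : ℤ) → (i : ℤ) < N → V i 0 = ((a + 1 + eB + (i - n₃)) - a') / 2 ∧
      V i 1 = (a + 1 + eB + (i - n₃)) - ((a + 1 + eB + (i - n₃)) - a') / 2 := by
    intro i k3 h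
    have k1 : ¬ (i : ℤ) < n₁ := by omega
    have k2 : ¬ (i : ℤ) < n₂ := by omega
    rw [hV]; dsimp only; rw [if_neg k1, if_neg k2, if_neg (not_lt.2 k3), if_pos h]; exact ⟨rfl, rfl⟩
  have lE : ∀ i : ℕ, N ≤ (i : ℤ) → V i 0 = (b - (a' + 1)) / 2 ∧ V i 1 = (b - (a' + 1)) / 2 + (a' + 1) := by
    intro i h
    have k1 : ¬ (i : ℤ) < n₁ := by omega
    have k2 : ¬ (i : ℤ) < n₂ := by omega
    have k3 : ¬ (i : ℤ) < n₃ := by omega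
    rw [hV]; dsimp only; rw [if_neg k1, if_neg k2, if_neg k3, if_neg (not_lt.2 h)]; exact ⟨rfl, rfl⟩
  have hN0 : ((N.toNat : ℕ) : ℤ) = N := Int.toNat_of_nonneg (by omega)
  refine ⟨V, N.toNat, by omega, fun i _ => lap_mem_frame hq hdef lR lT lL lB lE i, fun i hi => ?_,
    lap_close hq hdef lR lE, fun i j hij hj => lap_injOn hq hdef lR lT lL lB i j hij (by omega), fun x hx hfr hna => ?_⟩
  · rw [zdGraph_adj_iff_coord]
    exact lap_step hq hdef lR lT lL lB lE i (by omega)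
  · obtain ⟨i, hi, he⟩ := exists_lap_eq hq hdef lR lT lL lB x hx hfr hna
    exact ⟨i, by omega, he⟩

end Summit.CriticalPhenomena.CardyFormulaZ2.Cruxes.ParafermionToSLESixFamilies.PotentialDarbouxPicardDiamond

end
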